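import Mathlib
import HarnessLib

/-!
# `CompletionRelayChain` — crux `RelayFrontStep` (24850), LINE `window_v2`, stub `stub_ignition` (Phase II):
  one-sided linear comparison with a time-dependent source (for the next-shell trigger floor)

`linear_comparison_int`: if `y′ ≤ k(t)·y + β(t)` on `[a,b]` with `k, β` continuous, `0 ≤ k ≤ K` and `β ≥ 0`,
then `y(t) ≤ max 0 (y(a) + ∫ₐᵗ β) · exp(K(t − a))`. (The constant-source case is `linear_comparison_var`,
tree `…IgnitionLinear`; the floor of the old shell-2 trigger needs the source `0.177·(r₁u₁)⁻ + κ√F` integrated,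
because `∫₀^{T*}|u₁| ≤ 0.067` while `sup |u₁| · T* = 0.37`.)

No definitions. HONEST FRAMING: elementary calculus; helper for the crux, no stub credit; nothing here is a statement
about the Navier–Stokes equations.
-/

noncomputable section

-- the summit-side namespace repeats a component by design (D-0017)
set_option linter.dupNamespace false

open Set MeasureTheory intervalIntegral

namespace Summit.NavierStokesRegularity.NavierStokesRegularity.Cruxes.RelayFrontStep.Window2

/-- **Variable-coefficient, variable-source one-sided linear comparison.** Let `y` be `C¹` on `[0,τ]`, `k, β`
continuous on `[0,τ]`, `[a,b] ⊆ [0,τ]`, and on `[a,b]`: `derivWithin y ≤ k·y + β`, `0 ≤ k ≤ K`, `0 ≤ β`. Then for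
`t ∈ [a,b]`, `y(t) ≤ max 0 (y(a) + ∫ₐᵗ β) · exp(K(t − a))`. [folklore] -/
theorem linear_comparison_int {y k β : ℝ → ℝ} {τ a b K : ℝ} (hy : ContDiffOn ℝ 1 y (Icc 0 τ))
    (hk : ContinuousOn k (Icc 0 τ)) (hβc : ContinuousOn β (Icc 0 τ)) (ha : 0 ≤ a) (hab : a ≤ b) (hb : b ≤ τ)
    (hβ : ∀ s ∈ Icc a b, 0 ≤ β s)
    (hk0 : ∀ s ∈ Icc a b, 0 ≤ k s) (hkK : ∀ s ∈ Icc a b, k s ≤ K)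
    (hy' : ∀ s ∈ Icc a b, derivWithin y (Icc 0 τ) s ≤ k s * y s + β s) :
    ∀ t ∈ Icc a b, y t ≤ max 0 (y a + ∫ s in a..t, β s) * Real.exp (K * (t - a)) := by
  have hsubI : Icc a b ⊆ Icc 0 τ := Icc_subset_Icc ha hb
  have hkab : ContinuousOn k (Icc a b) := hk.mono hsubI
  have hβab : ContinuousOn β (Icc a b) := hβc.mono hsubI
  -- primitives of k and β on [a,b]: derivative at interior points, continuity
  have hprim : ∀ {g : ℝ → ℝ}, ContinuousOn g (Icc a b) →
      (∀ t ∈ Ioo a b, HasDerivAt (fun t => ∫ s in a..t, g s) (g t) t) ∧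
        ContinuousOn (fun t => ∫ s in a..t, g s) (Icc a b) := by
    intro g hg
    refine ⟨fun t ht => ?_, ?_⟩
    · have hint : IntervalIntegrable g volume a t :=
        (hg.mono (by rw [uIcc_of_le ht.1.le]; exact Icc_subset_Icc_right ht.2.le)).intervalIntegrable
      have hmem : Icc a b ∈ nhds t := Icc_mem_nhds ht.1 ht.2
      have hcont : ContinuousAt g t := hg.continuousAt hmem
      have hmeas : StronglyMeasurableAtFilter g (nhds t) volume :=
        ContinuousOn.stronglyMeasurableAtFilter isOpen_Ioo (hg.mono Ioo_subset_Icc_self) t ht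
      exact intervalIntegral.integral_hasDerivAt_right hint hmeas hcont
    · have h := intervalIntegral.continuousOn_primitive_interval (μ := volume) (f := g) (a := a) (b := b)
        ((hg.integrableOn_Icc).mono_set (by rw [uIcc_of_le hab]))
      rwa [uIcc_of_le hab] at h
  obtain ⟨hPderiv, hPcont⟩ := hprim hkab
  obtain ⟨hBderiv, hBcont⟩ := hprim hβab
  set P : ℝ → ℝ := fun t => ∫ s in a..t, k s with hP
  set B : ℝ → ℝ := fun t => ∫ s in a..t, β s with hB
  have hPnonneg : ∀ t ∈ Icc a b, 0 ≤ P t := fun t ht =>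
    intervalIntegral.integral_nonneg ht.1 fun s hs => hk0 s ⟨hs.1, hs.2.trans ht.2⟩
  have hPle : ∀ t ∈ Icc a b, P t ≤ K * (t - a) := by
    intro t ht
    have hint : IntervalIntegrable k volume a t :=
      (hkab.mono (by rw [uIcc_of_le ht.1]; exact Icc_subset_Icc_right ht.2)).intervalIntegrable
    have h := intervalIntegral.integral_mono_on ht.1 hint (by simp : IntervalIntegrable (fun _ => K) volume a t)
      fun s hs => hkK s ⟨hs.1, hs.2.trans ht.2⟩
    rw [intervalIntegral.integral_const, smul_eq_mul] at h
    simpa [hP, mul_comm] using h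
  -- z(t) := y(t) e^{−P(t)} − B(t) is antitone on [a,b]
  set z : ℝ → ℝ := fun t => y t * Real.exp (-P t) - B t with hz
  have hzc : ContinuousOn z (Icc a b) := ((hy.continuousOn.mono hsubI).mul (hPcont.neg.rexp)).sub hBcont
  have hzd : DifferentiableOn ℝ z (interior (Icc a b)) := by
    rw [interior_Icc]; intro t ht
    have htI : Icc 0 τ ∈ nhds t := Icc_mem_nhds (lt_of_le_of_lt ha ht.1) (lt_of_lt_of_le ht.2 hb)
    have hyd : DifferentiableAt ℝ y t :=
      ((hy.differentiableOn one_ne_zero) t (hsubI ⟨ht.1.le, ht.2.le⟩)).differentiableAt htI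
    exact ((hyd.mul (hPderiv t ht).neg.exp.differentiableAt).sub (hBderiv t ht).differentiableAt).differentiableWithinAt
  have hz' : ∀ t ∈ interior (Icc a b), deriv z t ≤ 0 := by
    rw [interior_Icc]; intro t ht
    have htI : Icc 0 τ ∈ nhds t := Icc_mem_nhds (lt_of_le_of_lt ha ht.1) (lt_of_lt_of_le ht.2 hb)
    have hmem : t ∈ Icc 0 τ := hsubI ⟨ht.1.le, ht.2.le⟩
    have hyd : DifferentiableWithinAt ℝ y (Icc 0 τ) t := (hy.differentiableOn one_ne_zero) t hmem
    have hyda : HasDerivAt y (derivWithin y (Icc 0 τ) t) t := by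
      rw [derivWithin_of_mem_nhds htI]; exact (hyd.differentiableAt htI).hasDerivAt
    have hE : HasDerivAt (fun t => Real.exp (-P t)) (Real.exp (-P t) * (-k t)) t := (hPderiv t ht).neg.exp
    have hder : HasDerivAt z (derivWithin y (Icc 0 τ) t * Real.exp (-P t) + y t * (Real.exp (-P t) * (-k t)) - β t) t :=
      (hyda.mul hE).sub (hBderiv t ht)
    rw [hder.deriv]
    have hpos : 0 < Real.exp (-P t) := Real.exp_pos _
    have hle1 : Real.exp (-P t) ≤ 1 := by
      rw [Real.exp_le_one_iff]; linarith [hPnonneg t ⟨ht.1.le, ht.2.le⟩]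
    have h1 := hy' t ⟨ht.1.le, ht.2.le⟩
    have hβt := hβ t ⟨ht.1.le, ht.2.le⟩
    have h2 : (derivWithin y (Icc 0 τ) t - k t * y t) * Real.exp (-P t) ≤ β t * Real.exp (-P t) :=
      mul_le_mul_of_nonneg_right (by linarith) hpos.le
    have h3 : β t * Real.exp (-P t) ≤ β t := by nlinarith
    nlinarith
  have hanti : AntitoneOn z (Icc a b) := antitoneOn_of_deriv_nonpos (convex_Icc a b) hzc hzd hz'
  intro t ht
  have h1 := hanti (left_mem_Icc.mpr hab) ht ht.1
  have hPa : P a = 0 := by simp [hP]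
  have hBa : B a = 0 := by simp [hB]
  simp only [hz, hPa, hBa, neg_zero, Real.exp_zero, mul_one, sub_zero] at h1
  have hposP : 0 < Real.exp (P t) := Real.exp_pos _
  have e : Real.exp (-P t) * Real.exp (P t) = 1 := by rw [← Real.exp_add]; simp
  have h2 : y t * Real.exp (-P t) ≤ y a + B t := by linarith
  have h3 : y t ≤ (y a + B t) * Real.exp (P t) := by
    calc y t = (y t * Real.exp (-P t)) * Real.exp (P t) := by rw [mul_assoc, e, mul_one]
      _ ≤ (y a + B t) * Real.exp (P t) := mul_le_mul_of_nonneg_right h2 hposP.le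
  have h4 : Real.exp (P t) ≤ Real.exp (K * (t - a)) := Real.exp_le_exp.mpr (hPle t ht)
  have h5 : (y a + B t) * Real.exp (P t) ≤ max 0 (y a + B t) * Real.exp (P t) :=
    mul_le_mul_of_nonneg_right (le_max_right _ _) hposP.le
  have h6 : max 0 (y a + B t) * Real.exp (P t) ≤ max 0 (y a + B t) * Real.exp (K * (t - a)) :=
    mul_le_mul_of_nonneg_left h4 (le_max_left _ _)
  show y t ≤ max 0 (y a + B t) * Real.exp (K * (t - a))
  linarith

end Summit.NavierStokesRegularity.NavierStokesRegularity.Cruxes.RelayFrontStep.Window2
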